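import Mathlib.Analysis.Convex.Deriv
import Literature.MathematicalPhysics.QuantumLattice.SourcedGroundEnergyCusp
import Literature.MathematicalPhysics.QuantumLattice.DWaveOrderParameterProofs
import HarnessLib

/-!
# The `d`-wave order parameter is the CUSP of the thermodynamic-limit sourced energy density:
# Griffiths' lemma in the source `h` and `dWaveOrderParameter U μ = −½ ∂⁺g(0)` (conditional on the limit)

Topic `Literature/MathematicalPhysics/QuantumLattice` (namespace = path). Proof-only companion of
`DWaveSource.lean` / `DWaveSourceProofs.lean` / `DWaveOrderParameterProofs.lean`: the Koma–Tasaki `d`-wave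
order parameter `dWaveOrderParameter U μ = ⨅_{h>0} liminf_L m_{L+1}(h)` (`dWaveOrderParameter_eq_iInf`) of
the pair-sourced grand-canonical Hubbard torus `dWaveSourceTorus L U μ h = H(1,U) − μN − h(Δ_d + Δ_d†)`,
sourced pair density `m_L(h) = dWaveSourceDensity L U μ h = Re ω_h(Δ_d)/L²`, sourced ground energies
`E_L(h) = E₀(dWaveSourceTorus L U μ h)`. The model-free real analysis is `SourcedGroundEnergyCusp.lean`
(namespace `SourceSandwich`); this file instantiates it. Written for the pinning-field programme of the
Hubbard ladder (rung CQ, rows PC-a "pinning-field response" / PC-c "non-analyticity of `e₀(h)`").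
No definition, no named fact, no `sorry`; zero compute.

## Contents

* FINITE VOLUME: the per-site Hellmann–Feynman sandwich `(h′ − h)·2m_L(h) ≤ E_L(h)/L² − E_L(h′)/L²`
  (`dWaveSource_sandwich`, = `dWaveSourceDensity_mul_le_groundEnergy_drop`); `h ↦ E_L(h)` is CONCAVE on
  `ℝ` (`concaveOn_groundEnergy_dWaveSourceTorus`) and `2B_dL²`-Lipschitz
  (`abs_groundEnergy_dWaveSourceTorus_sub_le`; `B_d = 2Σ_e|d(e)/√2| = 4√2`, the tree's bound on `|m_L|`).
* THERMODYNAMIC LIMIT, CONDITIONAL on the sourced energy density: IF `E_{L+1}(h)/(L+1)² → g(h)` for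
  every `h ≥ 0` (hypothesis `hg`, the shape used in `SourcedOrderParameterFloor.lean` §3 on the Summits
  side; the existence of this limit is NOT in the tree for `d = 2`), THEN
  - `g` is concave and `2B_d`-Lipschitz on `[0,∞)`;
  - GRIFFITHS' LEMMA in the source: at a differentiability point `h` of `g`, `m_{L+1}(h) → −g′(h)/2`;
    one-sided: `−g′₋(h)/2 ≤ liminf_L m_{L+1}(h)`, `limsup_L m_{L+1}(h) ≤ −g′₊(h)/2`
    (Griffiths 1966 §II; the `μ`-direction twin is `tendsto_gcDensity_of_hasDerivAt`);
  - THE CUSP IDENTITY `dWaveOrderParameter U μ = ⨅_{h>0} (g(0) − g(h))/(2h) = lim_{h→0⁺} (g(0) − g(h))/(2h)`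
    (the secant is non-decreasing in `h`), `= −g′₊(0)/2` whenever `g` has a right derivative at `0`;
  - `HasDWaveOrder U μ ↔ ∃ c > 0, ∀ h > 0, g(h) ≤ g(0) − 2ch` (Koma–Tasaki `d`-wave order IS a linear
    cusp of the sourced energy density at `h = 0`), `HasDWaveOrder U μ ↔ g′₊(0) < 0` when the right
    derivative exists, and no kink (`g′₊(0) = 0`) ⇒ `¬ HasDWaveOrder U μ`.
  So LADDER rows PC-c (non-analyticity of `e₀(h)` at `h = 0`) and PC-a (pinning-field response `h → 0⁺`)
  ask for the same certified object: the modulus of the cusp of `g` at `0`.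

## What is NOT here (honest scope)

* The EXISTENCE of `g` is a hypothesis; nothing here constructs it. A certified floor on `m_L(h)` or on
  the gain `g(0) − g(h)` at ONE `h > 0` bounds `dWaveOrderParameter` from ABOVE only
  (`dWaveOrderParameter_le_liminf`, and here `dWaveOrderParameter ≤ (g(0) − g(h))/(2h)`); a floor needs
  every stair (`le_dWaveOrderParameter_iff_forall`) — the cusp identity names the missing `h → 0⁺`
  uniformity exactly.
* No inequality relating `dWaveOrderParameter` to long-range order (Kennedy–Lieb–Shastry 1988 /
  Koma–Tasaki 1993 go LRO ⇒ response; the converse is the catalogued barrier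
  `Literature.Barriers.HubbardSuperconductivity.SourcedOrderWithoutGroundStateLRO`).
* Window-fed finite-volume / stair brackets: `SourcedOrderParameterFloor.lean`,
  `SourcedOrderParameterCeiling.lean` (Summits side), `GroundStateSourceWindowBracket.lean`; not restated.
  The `t′ ≠ 0` twin (`dWaveSourceTorusTT'`, `dWaveOrderParameterTT'`) is the same instantiation of
  `SourceSandwich` with `dWaveSourceDensityTT'_mul_le_groundEnergy_drop`, left to its owner.

## References

* R. B. Griffiths, *Spontaneous magnetization in idealized ferromagnets*, Phys. Rev. 152 (1966)
  240–246, §II. [cite: Griffiths1966, §II]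
* T. Koma, H. Tasaki, *Symmetry breaking and finite-size effects in quantum many-body systems*,
  J. Stat. Phys. 76 (1994) 745–803, §1. [cite: KomaTasaki1994, §1]
-/

noncomputable section

namespace Literature.MathematicalPhysics.QuantumLattice

open Filter Set
open scoped Topology

/-! ### Finite volume -/

section DWave

open Literature.Probability.LatticeModels

variable (U μ : ℝ)

/-- The Hellmann–Feynman sandwich PER SITE for the `d`-wave sourced torus:
`(h′ − h)·2m_L(h) ≤ E_L(h)/L² − E_L(h′)/L²` for all real `h, h′`
(`dWaveSourceDensity_mul_le_groundEnergy_drop`). [cite: KomaTasaki1994, §1] -/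
theorem dWaveSource_sandwich (L : ℕ) [NeZero L] (h h' : ℝ) :
    (h' - h) * (2 * dWaveSourceDensity L U μ h) ≤
      (dWaveSourceTorus L U μ h).groundEnergy / (L : ℝ) ^ 2 -
        (dWaveSourceTorus L U μ h').groundEnergy / (L : ℝ) ^ 2 := by
  have key := dWaveSourceDensity_mul_le_groundEnergy_drop (L := L) U μ h h'
  have hL := cast_sq_pos_of_neZero L
  rw [← sub_div, le_div_iff₀ hL]
  calc (h' - h) * (2 * dWaveSourceDensity L U μ h) * (L : ℝ) ^ 2
      = (h' - h) * (2 * (L : ℝ) ^ 2 * dWaveSourceDensity L U μ h) := by ring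
    _ ≤ _ := key

/-- **Concavity in the source, finite volume**: `h ↦ E₀(dWaveSourceTorus L U μ h)` is concave on `ℝ`
(a minimum of affine functions of `h`; here from the Hellmann–Feynman sandwich).
[cite: KomaTasaki1994, §1] -/
theorem concaveOn_groundEnergy_dWaveSourceTorus (L : ℕ) [NeZero L] :
    ConcaveOn ℝ Set.univ fun h : ℝ => (dWaveSourceTorus L U μ h).groundEnergy :=
  SourceSandwich.concaveOn_univ (r := fun h => (L : ℝ) ^ 2 * dWaveSourceDensity L U μ h) fun h h' => by
    simpa only [mul_assoc] using dWaveSourceDensity_mul_le_groundEnergy_drop (L := L) U μ h h'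

/-- **Lipschitz continuity in the source, finite volume**:
`|E₀(dWaveSourceTorus L U μ h) − E₀(dWaveSourceTorus L U μ h′)| ≤ 2B_d L² |h − h′|`,
`B_d = 2Σ_e|d(e)/√2|` (Weyl; Israel's Thm. I.3.4 is the pressure version). [cite: Israel1979, Thm. I.3.4] -/
theorem abs_groundEnergy_dWaveSourceTorus_sub_le (L : ℕ) [NeZero L] (h h' : ℝ) :
    |(dWaveSourceTorus L U μ h).groundEnergy - (dWaveSourceTorus L U μ h').groundEnergy| ≤
      2 * ((2 * ∑ e ∈ insert (0 : Site 2) unitSteps, |dWaveFormFactor e / Real.sqrt 2|) * (L : ℝ) ^ 2) *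
        |h - h'| := by
  refine SourceSandwich.abs_sub_le (e := fun h => (dWaveSourceTorus L U μ h).groundEnergy)
    (r := fun h => (L : ℝ) ^ 2 * dWaveSourceDensity L U μ h)
    (B := (2 * ∑ e ∈ insert (0 : Site 2) unitSteps, |dWaveFormFactor e / Real.sqrt 2|) * (L : ℝ) ^ 2)
    (fun h h' => ?_) (fun h => ?_) h h'
  · simpa only [mul_assoc] using dWaveSourceDensity_mul_le_groundEnergy_drop (L := L) U μ h h'
  · rw [abs_mul, abs_of_nonneg (by positivity), mul_comm]
    exact mul_le_mul_of_nonneg_right (abs_dWaveSourceDensity_le L U μ h) (by positivity)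

/-! #### Thermodynamic limit, conditional on the sourced energy density `g` -/

/-- IF `E_{L+1}(h)/(L+1)² → g(h)` for all `h ≥ 0`, THEN `g` is concave on `[0,∞)`.
[cite: KomaTasaki1994, §1] -/
theorem concaveOn_Ici_of_tendsto_groundEnergy_dWaveSource {g : ℝ → ℝ}
    (hg : ∀ h : ℝ, 0 ≤ h → Tendsto (fun L : ℕ =>
      (dWaveSourceTorus (L + 1) U μ h).groundEnergy / (((L + 1 : ℕ) : ℝ)) ^ 2) atTop (𝓝 (g h))) :
    ConcaveOn ℝ (Set.Ici 0) g :=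
  SourceSandwich.concaveOn_Ici (m := fun L h => dWaveSourceDensity (L + 1) U μ h)
    (fun L h h' => dWaveSource_sandwich U μ (L + 1) h h') hg

/-- IF the limits exist at `h, h′`, THEN `|g(h) − g(h′)| ≤ 2B_d|h − h′|`. [cite: Israel1979, Thm. I.3.4] -/
theorem abs_sub_le_of_tendsto_groundEnergy_dWaveSource {g : ℝ → ℝ} {h h' : ℝ}
    (hgh : Tendsto (fun L : ℕ =>
      (dWaveSourceTorus (L + 1) U μ h).groundEnergy / (((L + 1 : ℕ) : ℝ)) ^ 2) atTop (𝓝 (g h)))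
    (hgh' : Tendsto (fun L : ℕ =>
      (dWaveSourceTorus (L + 1) U μ h').groundEnergy / (((L + 1 : ℕ) : ℝ)) ^ 2) atTop (𝓝 (g h'))) :
    |g h - g h'| ≤ 2 * (2 * ∑ e ∈ insert (0 : Site 2) unitSteps, |dWaveFormFactor e / Real.sqrt 2|) *
      |h - h'| :=
  SourceSandwich.abs_sub_le_of_tendsto (m := fun L h => dWaveSourceDensity (L + 1) U μ h)
    (fun L h h' => dWaveSource_sandwich U μ (L + 1) h h')
    (fun L h => abs_dWaveSourceDensity_le (L + 1) U μ h) hgh hgh'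

/-- **Griffiths' lemma in the source** (conditional): IF `E_{L+1}(h′)/(L+1)² → g(h′)` for every `h′`
near `h` and `g` is differentiable at `h` with derivative `g′`, THEN the sourced pair densities converge,
`m_{L+1}(h) → −g′/2`. [cite: Griffiths1966, §II] -/
theorem tendsto_dWaveSourceDensity_of_hasDerivAt {g : ℝ → ℝ} {h g' : ℝ}
    (hg : ∀ᶠ h' in 𝓝 h, Tendsto (fun L : ℕ =>
      (dWaveSourceTorus (L + 1) U μ h').groundEnergy / (((L + 1 : ℕ) : ℝ)) ^ 2) atTop (𝓝 (g h')))
    (hd : HasDerivAt g g' h) :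
    Tendsto (fun L : ℕ => dWaveSourceDensity (L + 1) U μ h) atTop (𝓝 (-g' / 2)) :=
  SourceSandwich.tendsto_of_hasDerivAt (m := fun L h => dWaveSourceDensity (L + 1) U μ h)
    (fun L h h' => dWaveSource_sandwich U μ (L + 1) h h')
    (fun L h => abs_dWaveSourceDensity_le (L + 1) U μ h) hg hd

/-- **Griffiths' lemma in the source, left half** (conditional): a LEFT derivative `g′₋(h)` of the
limit energy density bounds the stair from below, `−g′₋(h)/2 ≤ liminf_L m_{L+1}(h)`.
[cite: Griffiths1966, §II] -/
theorem neg_half_deriv_le_liminf_dWaveSourceDensity {g : ℝ → ℝ} {h g' : ℝ}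
    (hg : ∀ᶠ h₁ in 𝓝[<] h, Tendsto (fun L : ℕ =>
      (dWaveSourceTorus (L + 1) U μ h₁).groundEnergy / (((L + 1 : ℕ) : ℝ)) ^ 2) atTop (𝓝 (g h₁)))
    (hgh : Tendsto (fun L : ℕ =>
      (dWaveSourceTorus (L + 1) U μ h).groundEnergy / (((L + 1 : ℕ) : ℝ)) ^ 2) atTop (𝓝 (g h)))
    (hd : HasDerivWithinAt g g' (Set.Iio h) h) :
    -g' / 2 ≤ liminf (fun L : ℕ => dWaveSourceDensity (L + 1) U μ h) atTop :=
  SourceSandwich.neg_half_deriv_le_liminf (m := fun L h => dWaveSourceDensity (L + 1) U μ h)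
    (fun L h h' => dWaveSource_sandwich U μ (L + 1) h h')
    (fun L h => abs_dWaveSourceDensity_le (L + 1) U μ h) hg hgh hd

/-- **Griffiths' lemma in the source, right half** (conditional): a RIGHT derivative `g′₊(h)` of the
limit energy density bounds the stair from above, `limsup_L m_{L+1}(h) ≤ −g′₊(h)/2`.
[cite: Griffiths1966, §II] -/
theorem limsup_dWaveSourceDensity_le_neg_half_deriv {g : ℝ → ℝ} {h g' : ℝ}
    (hg : ∀ᶠ h₂ in 𝓝[>] h, Tendsto (fun L : ℕ =>
      (dWaveSourceTorus (L + 1) U μ h₂).groundEnergy / (((L + 1 : ℕ) : ℝ)) ^ 2) atTop (𝓝 (g h₂)))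
    (hgh : Tendsto (fun L : ℕ =>
      (dWaveSourceTorus (L + 1) U μ h).groundEnergy / (((L + 1 : ℕ) : ℝ)) ^ 2) atTop (𝓝 (g h)))
    (hd : HasDerivWithinAt g g' (Set.Ioi h) h) :
    limsup (fun L : ℕ => dWaveSourceDensity (L + 1) U μ h) atTop ≤ -g' / 2 :=
  SourceSandwich.limsup_le_neg_half_deriv (m := fun L h => dWaveSourceDensity (L + 1) U μ h)
    (fun L h h' => dWaveSource_sandwich U μ (L + 1) h h')
    (fun L h => abs_dWaveSourceDensity_le (L + 1) U μ h) hg hgh hd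

/-- **THE CUSP IDENTITY, infimum form** (conditional): IF `E_{L+1}(h)/(L+1)² → g(h)` for all `h ≥ 0`,
THEN `dWaveOrderParameter U μ = ⨅_{h>0} (g(0) − g(h))/(2h)`: the Koma–Tasaki `d`-wave order parameter
is the largest `c` with `g(h) ≤ g(0) − 2ch` for all `h > 0`. [cite: KomaTasaki1994, §1] -/
theorem dWaveOrderParameter_eq_iInf_slope {g : ℝ → ℝ}
    (hg : ∀ h : ℝ, 0 ≤ h → Tendsto (fun L : ℕ =>
      (dWaveSourceTorus (L + 1) U μ h).groundEnergy / (((L + 1 : ℕ) : ℝ)) ^ 2) atTop (𝓝 (g h))) :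
    dWaveOrderParameter U μ = ⨅ h : Set.Ioi (0 : ℝ), (g 0 - g h) / (2 * h) := by
  rw [dWaveOrderParameter_eq_iInf]
  exact SourceSandwich.iInf_liminf_eq_iInf_slope (m := fun L h => dWaveSourceDensity (L + 1) U μ h)
    (fun L h h' => dWaveSource_sandwich U μ (L + 1) h h')
    (fun L h => abs_dWaveSourceDensity_le (L + 1) U μ h) hg

/-- **THE CUSP IDENTITY, limit form** (conditional): IF `E_{L+1}(h)/(L+1)² → g(h)` for all `h ≥ 0`,
THEN `(g(0) − g(h))/(2h) → dWaveOrderParameter U μ` as `h → 0⁺` (the secant is non-decreasing in `h`,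
so this is also its infimum). [cite: KomaTasaki1994, §1] -/
theorem tendsto_slope_nhdsGT_dWaveOrderParameter {g : ℝ → ℝ}
    (hg : ∀ h : ℝ, 0 ≤ h → Tendsto (fun L : ℕ =>
      (dWaveSourceTorus (L + 1) U μ h).groundEnergy / (((L + 1 : ℕ) : ℝ)) ^ 2) atTop (𝓝 (g h))) :
    Tendsto (fun h : ℝ => (g 0 - g h) / (2 * h)) (𝓝[>] 0) (𝓝 (dWaveOrderParameter U μ)) := by
  rw [dWaveOrderParameter_eq_iInf]
  exact SourceSandwich.tendsto_slope_nhdsGT (m := fun L h => dWaveSourceDensity (L + 1) U μ h)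
    (fun L h h' => dWaveSource_sandwich U μ (L + 1) h h')
    (fun L h => abs_dWaveSourceDensity_le (L + 1) U μ h) hg

/-- **THE CUSP IDENTITY, derivative form** (conditional): IF `E_{L+1}(h)/(L+1)² → g(h)` for all
`h ≥ 0` and `g` has a right derivative `g′₊(0)` at `h = 0`, THEN `dWaveOrderParameter U μ = −g′₊(0)/2`.
[cite: Griffiths1966, §II] -/
theorem dWaveOrderParameter_eq_neg_half_deriv {g : ℝ → ℝ} {g' : ℝ}
    (hg : ∀ h : ℝ, 0 ≤ h → Tendsto (fun L : ℕ =>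
      (dWaveSourceTorus (L + 1) U μ h).groundEnergy / (((L + 1 : ℕ) : ℝ)) ^ 2) atTop (𝓝 (g h)))
    (hd : HasDerivWithinAt g g' (Set.Ioi 0) 0) :
    dWaveOrderParameter U μ = -g' / 2 := by
  rw [dWaveOrderParameter_eq_iInf]
  exact SourceSandwich.iInf_liminf_eq_neg_half_deriv (m := fun L h => dWaveSourceDensity (L + 1) U μ h)
    (fun L h h' => dWaveSource_sandwich U μ (L + 1) h h')
    (fun L h => abs_dWaveSourceDensity_le (L + 1) U μ h) hg hd

/-- **`d`-wave order IS a linear cusp of the sourced energy density** (conditional): IF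
`E_{L+1}(h)/(L+1)² → g(h)` for all `h ≥ 0`, THEN
`HasDWaveOrder U μ ↔ ∃ c > 0, ∀ h > 0, g(h) ≤ g(0) − 2ch`. [cite: KomaTasaki1994, §1] -/
theorem hasDWaveOrder_iff_linear_cusp {g : ℝ → ℝ}
    (hg : ∀ h : ℝ, 0 ≤ h → Tendsto (fun L : ℕ =>
      (dWaveSourceTorus (L + 1) U μ h).groundEnergy / (((L + 1 : ℕ) : ℝ)) ^ 2) atTop (𝓝 (g h))) :
    HasDWaveOrder U μ ↔ ∃ c : ℝ, 0 < c ∧ ∀ h : ℝ, 0 < h → g h ≤ g 0 - 2 * c * h := by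
  rw [hasDWaveOrder_iff, dWaveOrderParameter_eq_iInf]
  exact SourceSandwich.iInf_liminf_pos_iff_linear_cusp (m := fun L h => dWaveSourceDensity (L + 1) U μ h)
    (fun L h h' => dWaveSource_sandwich U μ (L + 1) h h')
    (fun L h => abs_dWaveSourceDensity_le (L + 1) U μ h) hg

/-- **No kink, no order** (conditional): IF `E_{L+1}(h)/(L+1)² → g(h)` for all `h ≥ 0` and the right
derivative of `g` at `0` vanishes, THEN `¬ HasDWaveOrder U μ`. [cite: KomaTasaki1994, §1] -/
theorem not_hasDWaveOrder_of_hasDerivWithinAt_zero {g : ℝ → ℝ}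
    (hg : ∀ h : ℝ, 0 ≤ h → Tendsto (fun L : ℕ =>
      (dWaveSourceTorus (L + 1) U μ h).groundEnergy / (((L + 1 : ℕ) : ℝ)) ^ 2) atTop (𝓝 (g h)))
    (hd : HasDerivWithinAt g 0 (Set.Ioi 0) 0) : ¬ HasDWaveOrder U μ := by
  rw [hasDWaveOrder_iff, dWaveOrderParameter_eq_neg_half_deriv U μ hg hd]
  norm_num

/-- **The sign of the kink decides** (conditional): IF `E_{L+1}(h)/(L+1)² → g(h)` for all `h ≥ 0` and
`g` has right derivative `g′₊(0)` at `0`, THEN `HasDWaveOrder U μ ↔ g′₊(0) < 0`. [cite: KomaTasaki1994, §1] -/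
theorem hasDWaveOrder_iff_deriv_neg {g : ℝ → ℝ} {g' : ℝ}
    (hg : ∀ h : ℝ, 0 ≤ h → Tendsto (fun L : ℕ =>
      (dWaveSourceTorus (L + 1) U μ h).groundEnergy / (((L + 1 : ℕ) : ℝ)) ^ 2) atTop (𝓝 (g h)))
    (hd : HasDerivWithinAt g g' (Set.Ioi 0) 0) : HasDWaveOrder U μ ↔ g' < 0 := by
  rw [hasDWaveOrder_iff, dWaveOrderParameter_eq_neg_half_deriv U μ hg hd]
  constructor <;> intro H <;> linarith

end DWave

/-! ### Appended 2026-08-26 (hubbard-cq-p5): the stair CONVERGES to the order parameter; Griffiths'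
bracket at EVERY `h > 0` by the one-sided derivatives of the concave limit energy (no differentiability
hypothesis); the right derivative of `g` tends to `−2·dWaveOrderParameter` as `h → 0⁺` -/

section Stair

variable (U μ : ℝ)

/-- **The stair converges** (unconditional): `liminf_L m_{L+1}(h) → dWaveOrderParameter U μ` as `h → 0⁺`
(the stair is non-decreasing and non-negative on `h > 0` and the order parameter is its infimum,
`dWaveOrderParameter_eq_iInf`). [cite: KomaTasaki1994, §1] -/
theorem tendsto_liminf_dWaveSourceDensity_nhdsGT :
    Tendsto (fun h : ℝ => liminf (fun L : ℕ => dWaveSourceDensity (L + 1) U μ h) atTop) (𝓝[>] 0)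
      (𝓝 (dWaveOrderParameter U μ)) := by
  have hmono : MonotoneOn (fun h : ℝ => liminf (fun L : ℕ => dWaveSourceDensity (L + 1) U μ h) atTop)
      (Set.Ioi 0) := fun h hh h' _ hle => liminf_dWaveSourceDensity_mono U μ (le_of_lt hh) hle
  have hbdd : BddBelow ((fun h : ℝ => liminf (fun L : ℕ => dWaveSourceDensity (L + 1) U μ h) atTop) ''
      Set.Ioi 0) := by
    refine ⟨0, ?_⟩
    rintro _ ⟨h, hh, rfl⟩
    exact liminf_dWaveSourceDensity_nonneg U μ (le_of_lt hh)
  have key := hmono.tendsto_nhdsGT hbdd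
  rwa [sInf_image', ← dWaveOrderParameter_eq_iInf] at key

variable {g : ℝ → ℝ}

/-- IF `E_{L+1}(h)/(L+1)² → g(h)` for all `h ≥ 0`, THEN at every `h > 0` the concave limit energy has a
right and a left derivative (`derivWithin g (Ioi h) h`, `derivWithin g (Iio h) h`; Mathlib's one-sided
differentiability of convex functions at interior points). [cite: KomaTasaki1994, §1] -/
theorem hasDerivWithinAt_Ioi_Iio_of_tendsto_groundEnergy_dWaveSource
    (hg : ∀ h : ℝ, 0 ≤ h → Tendsto (fun L : ℕ =>
      (dWaveSourceTorus (L + 1) U μ h).groundEnergy / (((L + 1 : ℕ) : ℝ)) ^ 2) atTop (𝓝 (g h)))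
    {h : ℝ} (hh : 0 < h) :
    HasDerivWithinAt g (derivWithin g (Set.Ioi h) h) (Set.Ioi h) h ∧
      HasDerivWithinAt g (derivWithin g (Set.Iio h) h) (Set.Iio h) h := by
  have hc := (concaveOn_Ici_of_tendsto_groundEnergy_dWaveSource U μ hg).neg
  have hint : h ∈ interior (Set.Ici (0 : ℝ)) := by
    rw [interior_Ici]
    exact hh
  have hR := (hc.differentiableWithinAt_Ioi_of_mem_interior hint).neg
  have hL := (hc.differentiableWithinAt_Iio_of_mem_interior hint).neg
  simp only [neg_neg] at hR hL
  exact ⟨hR.hasDerivWithinAt, hL.hasDerivWithinAt⟩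

/-- **Griffiths' bracket at every positive source, no differentiability hypothesis** (conditional on the
limits on `[0,∞)`): for `h > 0`,
`−∂⁻g(h)/2 ≤ liminf_L m_{L+1}(h) ≤ limsup_L m_{L+1}(h) ≤ −∂⁺g(h)/2`
with `∂^± g(h) = derivWithin g (Ioi h / Iio h) h` the one-sided derivatives of the concave limit energy.
[cite: Griffiths1966, §II] -/
theorem derivWithin_bracket_dWaveSourceDensity
    (hg : ∀ h : ℝ, 0 ≤ h → Tendsto (fun L : ℕ =>
      (dWaveSourceTorus (L + 1) U μ h).groundEnergy / (((L + 1 : ℕ) : ℝ)) ^ 2) atTop (𝓝 (g h)))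
    {h : ℝ} (hh : 0 < h) :
    -derivWithin g (Set.Iio h) h / 2 ≤ liminf (fun L : ℕ => dWaveSourceDensity (L + 1) U μ h) atTop ∧
      liminf (fun L : ℕ => dWaveSourceDensity (L + 1) U μ h) atTop ≤
        limsup (fun L : ℕ => dWaveSourceDensity (L + 1) U μ h) atTop ∧
      limsup (fun L : ℕ => dWaveSourceDensity (L + 1) U μ h) atTop ≤ -derivWithin g (Set.Ioi h) h / 2 := by
  obtain ⟨hR, hL⟩ := hasDerivWithinAt_Ioi_Iio_of_tendsto_groundEnergy_dWaveSource U μ hg hh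
  have hev : ∀ᶠ h' in 𝓝 h, Tendsto (fun L : ℕ =>
      (dWaveSourceTorus (L + 1) U μ h').groundEnergy / (((L + 1 : ℕ) : ℝ)) ^ 2) atTop (𝓝 (g h')) := by
    filter_upwards [Ioi_mem_nhds hh] with h' hh'
    exact hg h' (le_of_lt hh')
  refine ⟨neg_half_deriv_le_liminf_dWaveSourceDensity U μ (hev.filter_mono nhdsWithin_le_nhds)
      (hg h hh.le) hL, ?_, limsup_dWaveSourceDensity_le_neg_half_deriv U μ
      (hev.filter_mono nhdsWithin_le_nhds) (hg h hh.le) hR⟩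
  exact liminf_le_limsup
    (isBoundedUnder_of ⟨_, fun L => (abs_le.1 (abs_dWaveSourceDensity_le (L + 1) U μ h)).2⟩)
    (isBoundedUnder_of ⟨_, fun L => (abs_le.1 (abs_dWaveSourceDensity_le (L + 1) U μ h)).1⟩)

/-- **The right derivative tends to the cusp slope** (conditional on the limits on `[0,∞)`):
`−∂⁺g(h)/2 → dWaveOrderParameter U μ` as `h → 0⁺` — squeezed between the stair
`liminf_L m_{L+1}(h) → m*` and `2D(2h) − D(h) → m*`, `D(h) = (g(0) − g(h))/(2h)` (concavity:
`slope g h 2h ≤ ∂⁺g(h)`). So every finite-`h` reading — stair, `limsup`, secant `D`, one-sided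
derivatives — has the same limit `dWaveOrderParameter U μ` at `0⁺`. [cite: Griffiths1966, §II] -/
theorem tendsto_derivWithin_Ioi_nhdsGT_dWaveOrderParameter
    (hg : ∀ h : ℝ, 0 ≤ h → Tendsto (fun L : ℕ =>
      (dWaveSourceTorus (L + 1) U μ h).groundEnergy / (((L + 1 : ℕ) : ℝ)) ^ 2) atTop (𝓝 (g h))) :
    Tendsto (fun h : ℝ => -derivWithin g (Set.Ioi h) h / 2) (𝓝[>] 0) (𝓝 (dWaveOrderParameter U μ)) := by
  have hc := concaveOn_Ici_of_tendsto_groundEnergy_dWaveSource U μ hg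
  have hD := tendsto_slope_nhdsGT_dWaveOrderParameter U μ hg
  have h2 : Tendsto (fun h : ℝ => 2 * h) (𝓝[>] 0) (𝓝[>] 0) := by
    refine tendsto_nhdsWithin_of_tendsto_nhds_of_eventually_within _ ?_ ?_
    · have : Tendsto (fun h : ℝ => 2 * h) (𝓝 0) (𝓝 (2 * 0)) := tendsto_const_nhds.mul tendsto_id
      rw [mul_zero] at this
      exact this.mono_left nhdsWithin_le_nhds
    · filter_upwards [self_mem_nhdsWithin] with h hh
      have hh' : (0 : ℝ) < h := hh
      exact Set.mem_Ioi.2 (by positivity)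
  have hD2 : Tendsto (fun h : ℝ => (g 0 - g (2 * h)) / (2 * (2 * h))) (𝓝[>] 0)
      (𝓝 (dWaveOrderParameter U μ)) := hD.comp h2
  have hup : Tendsto (fun h : ℝ => 2 * ((g 0 - g (2 * h)) / (2 * (2 * h))) - (g 0 - g h) / (2 * h))
      (𝓝[>] 0) (𝓝 (dWaveOrderParameter U μ)) := by
    have := (hD2.const_mul 2).sub hD
    rwa [show 2 * dWaveOrderParameter U μ - dWaveOrderParameter U μ = dWaveOrderParameter U μ by ring]
      at this
  refine tendsto_of_tendsto_of_tendsto_of_le_of_le' (tendsto_liminf_dWaveSourceDensity_nhdsGT U μ)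
    hup ?_ ?_
  · filter_upwards [self_mem_nhdsWithin] with h hh
    obtain ⟨-, h1, h2⟩ := derivWithin_bracket_dWaveSourceDensity U μ hg hh
    exact h1.trans h2
  · filter_upwards [self_mem_nhdsWithin] with h hh
    have hh' : (0 : ℝ) < h := hh
    obtain ⟨hR, -⟩ := hasDerivWithinAt_Ioi_Iio_of_tendsto_groundEnergy_dWaveSource U μ hg hh'
    have key := hc.slope_le_of_hasDerivWithinAt_Ioi (Set.mem_Ici.2 hh'.le)
      (Set.mem_Ici.2 (by positivity : (0 : ℝ) ≤ 2 * h)) (by linarith) hR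
    rw [slope_def_field] at key
    have e : 2 * ((g 0 - g (2 * h)) / (2 * (2 * h))) - (g 0 - g h) / (2 * h) =
        -((g (2 * h) - g h) / (2 * h - h)) / 2 := by
      field_simp
      ring
    rw [e]
    linarith

end Stair

end Literature.MathematicalPhysics.QuantumLattice

end
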